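import Literature.IUT.LogVolume.ArchimedeanTensorCopiesProofs
import Mathlib.LinearAlgebra.PiTensorProduct.Basis
import Mathlib.LinearAlgebra.PiTensorProduct.Finite
import Mathlib.LinearAlgebra.StdBasis
import Mathlib.LinearAlgebra.Dimension.Constructions
import Mathlib.LinearAlgebra.FiniteDimensional.Lemmas
import Mathlib.LinearAlgebra.Complex.FiniteDimensional
import HarnessLib

/-!
# [IUTchIV] Proposition 1.5 (iii): proofs, II — the tensor product metric, the canonical decomposition,
# existence of the decomposition and the factor `2^{|I|−1}`

Mochizuki, *Inter-universal Teichmüller theory IV*, RIMS manuscript (Apr. 2020; = PRIMS **57** (2021)),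
§1, Proposition 1.5 (iii), p. 15 (kurims `paper:url-56bcb0f95768`): "`M_I` admits a unique direct sum
decomposition as a direct sum of `2^{|I|−1}·|V|^{|I|}` copies of `ℂ` … The direct sum metric on `M_I` …
is equal to `2^{|I|−1}` times the original tensor product metric on `M_I`." Companion of
`ArchimedeanTensorCopies` (statements) and `ArchimedeanTensorCopiesProofs` (characters, (iv), count,
uniqueness). Classical finite-dimensional algebra; the tag form only reflects the series' key. Contents:

* `basisM`, `basisMI` — the orthonormal basis `(1_v, √−1_v)` of `M = ⊕_v ℂ_v` and the tensor basis of
  `M_I` (`Basis.piTensorProduct`); `tensorForm` = `B₀`, the bilinear form making the tensor basis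
  orthonormal; `isTensorMetric_tensorForm` (`B₀(⊗m, ⊗m') = ∏ ⟪m_i, m'_i⟫`, i.e. `B₀` IS the tensor product
  metric), `isTensorMetric_unique`, positive definiteness (`eq_zero_of_tensorForm_self_eq_zero`),
  `finrank_MI` (`dim_ℝ M_I = (2|V|)^{|I|}`);
* `canonicalHom = Φ₀ : M_I → ⊕_{V^I × {±}^{I∖{i₀}}} ℂ`, `x ↦ (χ_{w, ε}(x))` with `ε` normalised to `+` at a
  base point `i₀` (the copies of `ℂ` are the characters modulo global conjugation);
* **`sum_inner_canonicalHom_tprod` / `sum_inner_canonicalHom`** — the metric identity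
  `Σ_idx ⟪(Φ₀x)_idx, (Φ₀y)_idx⟫ = 2^{|I|−1}·B₀(x,y)` (on pure tensors: `Σ_{ε∈{±}^I} ∏ cj(ε_i) z_i =
  ∏ (z_i + z̄_i)` and the global conjugation halves the sum; then bilinearity);
* `canonicalHom_injective` (positivity), `canonicalHom_bijective` (dimension count),
  `canonicalDecomposition : Decomposition I V (Idx I V)`;
* **`prop15iii_decomposition_holds : Prop15iii_decomposition I V`** (existence with the printed count) and
  **`prop15iii_metric_holds : Prop15iii_metric I V`** (for EVERY decomposition and the tensor product
  metric, via uniqueness of both); `isEmpty_decomposition_of_isEmpty` records that `I = ∅` admits no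
  decomposition (`M_I = ℝ`), so the text's `I ≠ ∅` is exactly what is needed.

Nothing here takes a side on [IUTchIII] Cor. 3.12.
-/

noncomputable section

namespace Literature.IUT.LogVolume

namespace Prop15iii

open scoped TensorProduct ComplexConjugate
open Complex PiTensorProduct

variable (I V : Type) [Fintype I] [DecidableEq I] [Fintype V]

/-! ## The tensor product metric, concretely -/

/-- The orthonormal `ℝ`-basis `(1_v, √−1_v)_{v ∈ V}` of `M = ⊕_v ℂ_v` (Mathlib `Pi.basis` of
`Complex.basisOneI`). [claim: Mochizuki2012, status: disputed] -/
def basisM : Module.Basis (Σ _ : V, Fin 2) ℝ (M V) := Pi.basis fun _ => Complex.basisOneI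

/-- Coordinates in `basisM`: real and imaginary parts of the components.
[claim: Mochizuki2012, status: disputed] -/
theorem basisM_repr (m : M V) (q : Σ _ : V, Fin 2) :
    (basisM V).repr m q = ![(m q.1).re, (m q.1).im] q.2 := by
  obtain ⟨v, k⟩ := q
  simp [basisM, Pi.basis_repr, Complex.coe_basisOneI_repr]

/-- `basisM` is orthonormal for the direct sum metric: `Σ_q x_q y_q = ⟪x, y⟫`.
[claim: Mochizuki2012, status: disputed] -/
theorem sum_basisM_repr_mul (m m' : M V) :
    ∑ q, (basisM V).repr m q * (basisM V).repr m' q = dsInner V m m' := by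
  rw [dsInner, Fintype.sum_sigma]
  refine Finset.sum_congr rfl fun v _ => ?_
  rw [Fin.sum_univ_two, basisM_repr, basisM_repr, basisM_repr, basisM_repr, Complex.inner]
  simp only [Matrix.cons_val_zero, Matrix.cons_val_one, mul_re, conj_re, conj_im]
  ring

/-- The tensor basis `⊗_i b_{p(i)}` of `M_I` (`Basis.piTensorProduct`). [claim: Mochizuki2012, status: disputed] -/
def basisMI : Module.Basis (I → Σ _ : V, Fin 2) ℝ (MI I V) :=
  Basis.piTensorProduct fun _ => basisM V

/-- The tensor product metric of `M_I`, as the bilinear form making the tensor basis orthonormal: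
`B₀(x, y) := Σ_p x_p y_p`. [claim: Mochizuki2012, status: disputed] -/
def tensorForm : MI I V →ₗ[ℝ] MI I V →ₗ[ℝ] ℝ :=
  ∑ p, (LinearMap.mul ℝ ℝ).compl₁₂ ((basisMI I V).coord p) ((basisMI I V).coord p)

/-- Unfolding `tensorForm`. [claim: Mochizuki2012, status: disputed] -/
theorem tensorForm_apply (x y : MI I V) :
    tensorForm I V x y = ∑ p, (basisMI I V).repr x p * (basisMI I V).repr y p := by
  simp [tensorForm]

/-- `B₀` IS the tensor product metric: `B₀(⊗ m_i, ⊗ m'_i) = ∏_i ⟪m_i, m'_i⟫`.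
[claim: Mochizuki2012, status: disputed] -/
theorem isTensorMetric_tensorForm : IsTensorMetric I V (tensorForm I V) := by
  intro m m'
  rw [tensorForm_apply]
  simp only [basisMI, Basis.piTensorProduct_repr_tprod_apply, ← Finset.prod_mul_distrib]
  have key := (Fintype.prod_sum fun i q => (basisM V).repr (m i) q * (basisM V).repr (m' i) q).symm
  rw [key]
  exact Finset.prod_congr rfl fun i _ => sum_basisM_repr_mul V (m i) (m' i)

omit [DecidableEq I] in
/-- The tensor product metric is unique (pure tensors span `M_I`). [claim: Mochizuki2012, status: disputed] -/
theorem isTensorMetric_unique {B B' : MI I V →ₗ[ℝ] MI I V →ₗ[ℝ] ℝ} (hB : IsTensorMetric I V B)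
    (hB' : IsTensorMetric I V B') : B = B' := by
  refine PiTensorProduct.ext (MultilinearMap.ext fun m => PiTensorProduct.ext (MultilinearMap.ext fun m' => ?_))
  simp only [LinearMap.compMultilinearMap_apply]
  rw [hB m m', hB' m m']

/-- `B₀(x, x) ≥ 0`. [claim: Mochizuki2012, status: disputed] -/
theorem tensorForm_self_nonneg (x : MI I V) : 0 ≤ tensorForm I V x x := by
  rw [tensorForm_apply]
  exact Finset.sum_nonneg fun p _ => mul_self_nonneg _

/-- `B₀(x, x) = 0 ⟹ x = 0` (positive definiteness). [claim: Mochizuki2012, status: disputed] -/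
theorem eq_zero_of_tensorForm_self_eq_zero {x : MI I V} (h : tensorForm I V x x = 0) : x = 0 := by
  rw [tensorForm_apply] at h
  have hp : ∀ p, (basisMI I V).repr x p = 0 := by
    intro p
    have := (Finset.sum_eq_zero_iff_of_nonneg fun q _ => mul_self_nonneg ((basisMI I V).repr x q)).mp
      h p (Finset.mem_univ p)
    exact zero_eq_mul_self.mp this.symm
  exact (basisMI I V).repr.injective (Finsupp.ext fun p => by simpa using hp p) |>.trans rfl

/-- `dim_ℝ M_I = (2|V|)^{|I|}`. [claim: Mochizuki2012, status: disputed] -/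
theorem finrank_MI : Module.finrank ℝ (MI I V) = (2 * Fintype.card V) ^ Fintype.card I := by
  rw [Module.finrank_eq_card_basis (basisMI I V), Fintype.card_fun, Fintype.card_sigma]
  simp [mul_comm]

/-! ## The canonical decomposition: coordinates = characters `χ_{w,ε}` with `ε` normalised at a base point -/

section Canonical

variable [Nonempty I]

/-- A base point `i₀ ∈ I` (`I ≠ ∅`), used to normalise `ε ∈ {id, conj}^I` modulo the global
conjugation. [claim: Mochizuki2012, status: disputed] -/
def basePoint : I := Classical.arbitrary I

/-- Splitting `{±}^I = {±} × {±}^{I ∖ {i₀}}` (Mathlib `Equiv.funSplitAt`). [claim: Mochizuki2012, status: disputed] -/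
def splitEquiv : (I → Bool) ≃ Bool × ({i : I // i ≠ basePoint I} → Bool) :=
  Equiv.funSplitAt (basePoint I) Bool

/-- Extension of `ε' ∈ {±}^{I ∖ {i₀}}` by `+` (no conjugation) at `i₀`. [claim: Mochizuki2012, status: disputed] -/
def extend (ε' : {i : I // i ≠ basePoint I} → Bool) : I → Bool := (splitEquiv I).symm (false, ε')

/-- The index set of the copies of `ℂ`: `V^I × {±}^{I ∖ {i₀}}`, of cardinality `|V|^{|I|}·2^{|I|−1}`.
[claim: Mochizuki2012, status: disputed] -/
abbrev Idx : Type := (I → V) × ({i : I // i ≠ basePoint I} → Bool)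

/-- The canonical decomposition map `Φ₀ : M_I → ⊕_{(w,ε')} ℂ`, `x ↦ (χ_{w, extend ε'}(x))`, an
`ℝ`-algebra homomorphism. [claim: Mochizuki2012, status: disputed] -/
def canonicalHom : MI I V →ₐ[ℝ] (Idx I V → ℂ) :=
  AlgHom.pi fun idx : Idx I V => character I V idx.1 (extend I idx.2)

omit [Fintype V] in
/-- Unfolding `canonicalHom`. [claim: Mochizuki2012, status: disputed] -/
@[simp] theorem canonicalHom_apply (x : MI I V) (idx : Idx I V) :
    canonicalHom I V x idx = character I V idx.1 (extend I idx.2) x := rfl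

end Canonical

/-! ## The metric identity `Σ_idx |x_idx|² = 2^{|I|−1}·B₀(x,x)` on pure tensors -/

omit [Fintype V] in
/-- `Σ_{ε ∈ {±}^I} ∏_i cj(ε_i)(z_i) = ∏_i (z_i + z̄_i)`. [claim: Mochizuki2012, status: disputed] -/
theorem sum_prod_cj (z : I → ℂ) :
    ∑ ε : I → Bool, ∏ i, cj (ε i) (z i) = ∏ i, (z i + conj (z i)) := by
  classical
  rw [← Fintype.prod_sum fun i (b : Bool) => cj b (z i)]
  refine Finset.prod_congr rfl fun i _ => ?_
  rw [Fintype.sum_bool, cj_true, cj_false, add_comm]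

omit [Fintype I] [DecidableEq I] [Fintype V] in
/-- `cj(¬b)(z) = conj (cj b z)`. [claim: Mochizuki2012, status: disputed] -/
theorem cj_not (b : Bool) (z : ℂ) : cj (!b) z = conj (cj b z) := by
  cases b <;> simp

omit [DecidableEq I] [Fintype V] in
/-- A global conjugation does not change the real part of `∏_i cj(ε_i)(z_i)`.
[claim: Mochizuki2012, status: disputed] -/
theorem re_prod_cj_not (ε : I → Bool) (z : I → ℂ) :
    (∏ i, cj (!ε i) (z i)).re = (∏ i, cj (ε i) (z i)).re := by
  simp only [cj_not]
  rw [← map_prod, conj_re]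

section Canonical

variable [Nonempty I]

omit [Fintype I] in
/-- `extend` and its global conjugate exhaust `{±}^I`: flipping `extend (¬ε')` gives the extension by `−`.
[claim: Mochizuki2012, status: disputed] -/
theorem not_extend (ε' : {i : I // i ≠ basePoint I} → Bool) :
    (fun i => !extend I (fun j => !ε' j) i) = (splitEquiv I).symm (true, ε') := by
  funext i
  by_cases h : i = basePoint I
  · subst h; simp [extend, splitEquiv]
  · simp [extend, splitEquiv, h]

/-- Halving: a flip-invariant function summed over the normalised `ε` gives half the full sum.
[claim: Mochizuki2012, status: disputed] -/
theorem two_mul_sum_extend (f : (I → Bool) → ℝ) (hf : ∀ ε, f (fun i => !ε i) = f ε) :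
    2 * ∑ ε', f (extend I ε') = ∑ ε, f ε := by
  rw [← Equiv.sum_comp (splitEquiv I).symm, Fintype.sum_prod_type, Fintype.sum_bool, two_mul]
  congr 1
  -- the `true` half equals the `false` half via the involution `ε' ↦ ¬ε'`
  have hinv : Function.Involutive fun ε' : {i : I // i ≠ basePoint I} → Bool => fun j => !ε' j := by
    intro ε'; funext j; simp
  rw [← Equiv.sum_comp hinv.toPerm]
  refine Fintype.sum_congr _ _ fun ε' => ?_
  rw [Function.Involutive.coe_toPerm, ← not_extend, hf]

/-- `Σ_{ε'} Re ∏_i cj(extend ε' i)(z_i) = 2^{|I|−1}·∏_i Re z_i`. [claim: Mochizuki2012, status: disputed] -/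
theorem sum_re_prod_cj_extend (z : I → ℂ) :
    ∑ ε', (∏ i, cj (extend I ε' i) (z i)).re = 2 ^ (Fintype.card I - 1) * ∏ i, (z i).re := by
  have h2 : 2 * ∑ ε', (∏ i, cj (extend I ε' i) (z i)).re = ∑ ε : I → Bool, (∏ i, cj (ε i) (z i)).re :=
    two_mul_sum_extend I (fun ε => (∏ i, cj (ε i) (z i)).re) fun ε => re_prod_cj_not I ε z
  have h3 : ∑ ε : I → Bool, (∏ i, cj (ε i) (z i)).re = 2 ^ Fintype.card I * ∏ i, (z i).re := by
    rw [← Complex.re_sum, sum_prod_cj]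
    have : ∏ i, (z i + conj (z i)) = ((∏ i, (2 * (z i).re) : ℝ) : ℂ) := by
      rw [Complex.ofReal_prod]
      exact Finset.prod_congr rfl fun i _ => by rw [Complex.add_conj]
    rw [this, Complex.ofReal_re, Finset.prod_mul_distrib, Finset.prod_const, Finset.card_univ]
  obtain ⟨n, hn⟩ := Nat.exists_eq_succ_of_ne_zero (Fintype.card_ne_zero (α := I))
  rw [hn, Nat.succ_sub_one]
  rw [hn, pow_succ] at h3
  linarith

omit [Fintype I] [DecidableEq I] [Fintype V] [Nonempty I] in
/-- `cj` commutes with `z ↦ z'·z̄`: `cj e z' · conj (cj e z) = cj e (z'·z̄)`. [claim: Mochizuki2012, status: disputed] -/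
theorem cj_mul_conj_cj (e : Bool) (z z' : ℂ) : cj e z' * conj (cj e z) = cj e (z' * conj z) := by
  cases e <;> simp [map_mul]

/-- **The metric identity on pure tensors**: `Σ_idx ⟪Φ₀(⊗m)_idx, Φ₀(⊗m')_idx⟫ = 2^{|I|−1}·∏_i ⟪m_i, m'_i⟫`
("the direct sum metric on `M_I` … is equal to `2^{|I|−1}` times the original tensor product metric",
p. 15, on pure tensors). [claim: Mochizuki2012, status: disputed] -/
theorem sum_inner_canonicalHom_tprod (m m' : I → M V) :
    ∑ idx : Idx I V, inner ℝ (canonicalHom I V (tprod ℝ m) idx) (canonicalHom I V (tprod ℝ m') idx) =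
      2 ^ (Fintype.card I - 1) * ∏ i, dsInner V (m i) (m' i) := by
  have hterm : ∀ (w : I → V) (ε' : {i : I // i ≠ basePoint I} → Bool),
      inner ℝ (canonicalHom I V (tprod ℝ m) (w, ε')) (canonicalHom I V (tprod ℝ m') (w, ε')) =
        (∏ i, cj (extend I ε' i) (m' i (w i) * conj (m i (w i)))).re := by
    intro w ε'
    rw [canonicalHom_apply, canonicalHom_apply, character_tprod, character_tprod, Complex.inner,
      map_prod (starRingEnd ℂ), ← Finset.prod_mul_distrib]
    simp only [cj_mul_conj_cj]
  rw [Fintype.sum_prod_type]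
  simp only [hterm, sum_re_prod_cj_extend]
  rw [← Finset.mul_sum]
  congr 1
  have key := (Fintype.prod_sum fun i v => (m' i v * conj (m i v)).re).symm
  rw [key]
  refine Finset.prod_congr rfl fun i _ => ?_
  simp [dsInner, Complex.inner]

/-- **The metric identity**, polarized: `Σ_idx ⟪(Φ₀ x)_idx, (Φ₀ y)_idx⟫ = 2^{|I|−1}·B₀(x, y)` for all
`x, y ∈ M_I` (both sides are bilinear; equal on pure tensors). [claim: Mochizuki2012, status: disputed] -/
theorem sum_inner_canonicalHom (x y : MI I V) :
    ∑ idx : Idx I V, inner ℝ (canonicalHom I V x idx) (canonicalHom I V y idx) =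
      2 ^ (Fintype.card I - 1) * tensorForm I V x y := by
  let c : Idx I V → MI I V →ₗ[ℝ] ℂ := fun idx =>
    (LinearMap.proj idx : (Idx I V → ℂ) →ₗ[ℝ] ℂ) ∘ₗ (canonicalHom I V).toLinearMap
  let L : MI I V →ₗ[ℝ] MI I V →ₗ[ℝ] ℝ := ∑ idx, (innerₗ ℂ).compl₁₂ (c idx) (c idx)
  let R : MI I V →ₗ[ℝ] MI I V →ₗ[ℝ] ℝ := (2 ^ (Fintype.card I - 1) : ℝ) • tensorForm I V
  have hL : ∀ x y, L x y = ∑ idx : Idx I V, inner ℝ (canonicalHom I V x idx) (canonicalHom I V y idx) := by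
    intro x y
    simp [L, c, LinearMap.sum_apply]
  have hLR : L = R := by
    refine PiTensorProduct.ext (MultilinearMap.ext fun m => PiTensorProduct.ext
      (MultilinearMap.ext fun m' => ?_))
    simp only [LinearMap.compMultilinearMap_apply]
    rw [hL, sum_inner_canonicalHom_tprod]
    simp [R, isTensorMetric_tensorForm I V m m']
  rw [← hL, hLR]
  simp [R]

/-- `Φ₀` is injective: `Φ₀ x = 0` forces `B₀(x,x) = 0`, hence `x = 0` (positive definiteness of the
tensor product metric). [claim: Mochizuki2012, status: disputed] -/
theorem canonicalHom_injective : Function.Injective (canonicalHom I V) := by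
  rw [injective_iff_map_eq_zero]
  intro x hx
  have h := sum_inner_canonicalHom I V x x
  rw [hx] at h
  simp only [Pi.zero_apply, inner_zero_left, Finset.sum_const_zero] at h
  have h0 : tensorForm I V x x = 0 := by
    have h2 : (2 : ℝ) ^ (Fintype.card I - 1) ≠ 0 := pow_ne_zero _ two_ne_zero
    rcases mul_eq_zero.mp h.symm with h' | h'
    · exact absurd h' h2
    · exact h'
  exact eq_zero_of_tensorForm_self_eq_zero I V h0

/-- `Φ₀` is bijective (injective, and `dim_ℝ M_I = (2|V|)^{|I|} = 2·|V|^{|I|}·2^{|I|−1} = dim_ℝ ⊕_idx ℂ`).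
[claim: Mochizuki2012, status: disputed] -/
theorem canonicalHom_bijective : Function.Bijective (canonicalHom I V) := by
  refine ⟨canonicalHom_injective I V, ?_⟩
  have hfin : Module.finrank ℝ (MI I V) = Module.finrank ℝ (Idx I V → ℂ) := by
    rw [finrank_MI, Module.finrank_pi_fintype]
    simp only [Complex.finrank_real_complex, Finset.sum_const, Finset.card_univ, smul_eq_mul,
      Fintype.card_prod, Fintype.card_fun, Fintype.card_bool, Fintype.card_subtype_compl,
      Fintype.card_unique]
    obtain ⟨n, hn⟩ := Nat.exists_eq_succ_of_ne_zero (Fintype.card_ne_zero (α := I))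
    rw [hn, Nat.succ_sub_one, pow_succ, pow_succ, mul_pow]
    ring
  exact (LinearMap.injective_iff_surjective_of_finrank_eq_finrank hfin
    (f := (canonicalHom I V).toLinearMap)).mp (canonicalHom_injective I V)

/-- **The canonical direct sum decomposition** `Φ₀ : M_I ≅ ⊕_{V^I × {±}^{I∖{i₀}}} ℂ` of `ℝ`-algebras.
[claim: Mochizuki2012, status: disputed] -/
def canonicalDecomposition : Decomposition I V (Idx I V) :=
  AlgEquiv.ofBijective (canonicalHom I V) (canonicalHom_bijective I V)

/-- `canonicalDecomposition` is `Φ₀`. [claim: Mochizuki2012, status: disputed] -/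
@[simp] theorem canonicalDecomposition_apply (x : MI I V) :
    canonicalDecomposition I V x = canonicalHom I V x := rfl

/-- Coordinates of a pure tensor in the canonical decomposition:
`Φ₀(⊗_i m_i)_{(w,ε')} = ∏_i cj(extend ε' i)(m_i(w_i))`. [claim: Mochizuki2012, status: disputed] -/
theorem canonicalDecomposition_tprod (m : I → M V) (idx : Idx I V) :
    canonicalDecomposition I V (tprod ℝ m) idx = ∏ i, cj (extend I idx.2 i) (m i (idx.1 i)) := by
  rw [canonicalDecomposition_apply, canonicalHom_apply, character_tprod]

/-- **Prop. 1.5 (iii), existence and number of copies, holds**: `M_I` (`I ≠ ∅`) admits a direct sum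
decomposition into `2^{|I|−1}·|V|^{|I|}` copies of `ℂ`. [claim: Mochizuki2012, status: disputed] -/
theorem prop15iii_decomposition_holds : Prop15iii_decomposition I V := by
  classical
  exact ⟨Idx I V, inferInstance, ⟨canonicalDecomposition I V⟩,
    card_eq_of_decomposition (canonicalDecomposition I V)⟩

/-- The metric identity for the canonical decomposition: `Σ_idx |(Φ₀ x)_idx|² = 2^{|I|−1}·B₀(x,x)`.
[claim: Mochizuki2012, status: disputed] -/
theorem dsNormSq_canonicalDecomposition (x : MI I V) :
    dsNormSq (canonicalDecomposition I V) x = 2 ^ (Fintype.card I - 1) * tensorForm I V x x := by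
  rw [← sum_inner_canonicalHom]
  simp only [dsNormSq, canonicalDecomposition_apply, real_inner_self_eq_norm_sq]

end Canonical

omit [DecidableEq I] in
/-- No decomposition into copies of `ℂ` exists when `I = ∅` (`M_I = ℝ` is odd-dimensional).
[claim: Mochizuki2012, status: disputed] -/
theorem isEmpty_decomposition_of_isEmpty [IsEmpty I] {J : Type} [Fintype J]
    (Φ : Decomposition I V J) : False := by
  classical
  have h1 : Module.finrank ℝ (MI I V) = 1 := by
    rw [finrank_MI]; simp
  have h2 : Module.finrank ℝ (J → ℂ) = 2 * Fintype.card J := by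
    rw [Module.finrank_pi_fintype]
    simp [Complex.finrank_real_complex, mul_comm]
  have := Φ.toLinearEquiv.finrank_eq
  rw [h1, h2] at this
  omega

/-- **Prop. 1.5 (iii), metrics, holds**: for EVERY direct sum decomposition `Φ` and the tensor product
metric `B`, `Σ_j |Φ x j|² = 2^{|I|−1}·B(x, x)` (via uniqueness of decompositions and of `B`).
[claim: Mochizuki2012, status: disputed] -/
theorem prop15iii_metric_holds : Prop15iii_metric I V := by
  intro J _ Φ B hB x
  classical
  rcases isEmpty_or_nonempty I with hI | hI
  · exact (isEmpty_decomposition_of_isEmpty I V Φ).elim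
  · have hBeq : B = tensorForm I V := isTensorMetric_unique I V hB (isTensorMetric_tensorForm I V)
    obtain ⟨e, c, he⟩ :=
      prop15iii_unique_holds (I := I) (V := V) (Idx I V) J (canonicalDecomposition I V) Φ
    rw [hBeq, ← dsNormSq_canonicalDecomposition, dsNormSq, dsNormSq, ← Equiv.sum_comp e]
    simp only [he, norm_cj]

end Prop15iii

end Literature.IUT.LogVolume

end
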